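import Literature.Computability.QuantumComplexity.GRCosineMach
import HarnessLib

/-!
# The Grover–Rudolph cosine machine over an abstract level table

Topic `Literature/Computability/QuantumComplexity`; the generic form of `GRCosineMach.lean`. There ONE
polynomial-time Turing machine computes, on the data word of level `j` (the `j` prefix bits and the
parameter word `((S, (p, U)), (k, ℓ))`), the cosine word of the rotation of the Grover–Rudolph state
preparation [GroverRudolph2002, eq. (4)] for the CONCRETE mass table `GRMassTable.tableT` (Regev's sampler,
[Regev2009, Lemma 3.12 (proof), §2 p. 11]). Every step of that construction uses the table only through
(a) a polynomial-time CODE of the level word `(params, (j, h)) ↦ wordOfNat k (aOf k (T' j h) (T' (j+1) (2h)))`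
and (b) the agreement `T' j h = T j h` for `j ≤ ℓ` of the machine table `T'` with the analytic table `T`.
This file abstracts exactly that much:

* `LevelCode` — a structure `τ = (tab, tab', tab'_eq, code)`: the analytic table `τ.tab S p U ℓ`, the machine
  table `τ.tab'`, their agreement below `ℓ`, and a `CodeFP` witness of the level word of `τ.tab'`;
* `GRTableMach.mach τ S p U k ℓ np hnp : GRData.Mach ℓ np (wlen τ ℓ np) (k+1) (fun j y ↦ machineA k (τ.tab S p U ℓ) j y / 2ᵏ)`
  and `GRTableMach.data τ …` — the machine datum and the `GRBlock.Data` of the concrete Grover–Rudolph block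
  for ANY level code, with the definitional equations `mach_c`, `mach_M`, `mach_v`, `mach_fbits`;
* `LevelCode.cos` — the level code of `GRMassTable.tableT` (`GRCosineCodeFP.codeFP_levelWord`), so that
  `GRCosineMach` is the instance `τ := LevelCode.cos` up to the choice of machine.

The parameter word (`GRCosineMach.Par`, `pcode`, `cword`), the suffixes `v` and the cosine facts
`abs_cosA_le_one`, `cosA_update` are table-independent and reused from `GRCosineMach`. The point of the
abstraction is the CLAMPED table of `GRMassTableClamp.lean`, whose accuracy budget is independent of `S`
(sequel `GRCosineCodeFPClamp.lean` supplies its level code). Everything here is proved.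

## References

* O. Regev, *On lattices, learning with errors, random linear codes, and cryptography*, J. ACM 56 (2009),
  art. 34, Lemma 3.12 (proof), §2 p. 11 [Regev2009].
* L. Grover, T. Rudolph, *Creating superpositions that correspond to efficiently integrable probability
  distributions*, arXiv:quant-ph/0208112 (2002), eq. (1), (4) [GroverRudolph2002].
* S. Arora, B. Barak, *Computational Complexity: A Modern Approach*, CUP 2009, §1.3 [AroraBarak2009].
-/

noncomputable section

namespace Literature.Computability.QuantumComplexity

open Literature.Computability.Complexity Literature.Computability.Complexity.CodeFP Literature.Computability.Complexity.Brick
open _root_.Computability GaussianCells GRMassTable GRCosineCodeFP CleanBlockInput RevSim RevClean Turing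
open GRCosineMach (Par pcode cword ofFn_cword cword_apply fstF_pcode_append k_le_length_pcode v length_v le_JJ
  abs_cosA_le_one cosA_update)

/-- **A level code**: an analytic mass table `tab S p U ℓ : MassTable`, the machine's table `tab'` (total in
`j`), their agreement for `j ≤ ℓ`, and a polynomial-time code of the level word
`(((S, (p, U)), (k, ℓ)), (j, h)) ↦ wordOfNat k (aOf k (tab' j h) (tab' (j+1) (2h)))`. [cite: Regev2009, Lemma 3.12 (proof)] -/
structure LevelCode where
  /-- the analytic table -/
  tab : ℚ → ℕ → ℕ → ℕ → MassTable
  /-- the machine table -/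
  tab' : ℚ → ℕ → ℕ → ℕ → ℕ → ℕ → ℚ
  /-- they agree below `ℓ` -/
  tab'_eq : ∀ (S : ℚ) (p U : ℕ) {ℓ j : ℕ}, j ≤ ℓ → ∀ h : ℕ, tab' S p U ℓ j h = tab S p U ℓ j h
  /-- the level word of the machine table is polynomial time on codes -/
  code : CodeFP inE strE (fun q : LevelIn =>
    wordOfNat q.1.2.1 (aOf q.1.2.1 (tab' q.1.1.1 q.1.1.2.1 q.1.1.2.2 q.1.2.2 q.2.1 q.2.2)
      (tab' q.1.1.1 q.1.1.2.1 q.1.1.2.2 q.1.2.2 (q.2.1 + 1) (2 * q.2.2))))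

/-- **The level code of the unclamped table** `GRMassTable.tableT`. [cite: Regev2009, Lemma 3.12 (proof) with §2 p. 11] -/
def LevelCode.cos : LevelCode where
  tab := tableT
  tab' := tableT'
  tab'_eq S p U _ _ hj h := tableT'_eq (S := S) (p := p) (U := U) hj h
  code := codeFP_levelWord

namespace GRTableMach

variable (τ : LevelCode)

/-! ### The level function on strings -/

/-- The `FP` function of the level word on codes (`codeFP_levelWord`). [cite: Regev2009, Lemma 3.12 (proof)] -/
def fLevel : List Bool → List Bool := Classical.choose τ.code

/-- It is polynomial time. [cite: AroraBarak2009, §1.3] -/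
theorem fLevel_mem_FP : fLevel τ ∈ FP := (Classical.choose_spec τ.code).1

/-- Its value on a level-input code. [cite: Regev2009, Lemma 3.12 (proof)] -/
theorem fLevel_apply (q : LevelIn) : fLevel τ (inE q) =
    wordOfNat q.1.2.1 (aOf q.1.2.1 (τ.tab' q.1.1.1 q.1.1.2.1 q.1.1.2.2 q.1.2.2 q.2.1 q.2.2)
      (τ.tab' q.1.1.1 q.1.1.2.1 q.1.1.2.2 q.1.2.2 (q.2.1 + 1) (2 * q.2.2))) :=
  (Classical.choose_spec τ.code).2 q

/-- **The level function**: on the level `j` and a data word `d` (the `j` prefix bits, most significant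
first, then the parameter word) — the parameter code `fstF (d.drop j)`, the prefix value `⟦reverse (d.take j)⟧`,
and the level word of `fLevel`. [cite: Regev2009, Lemma 3.12 (proof)] -/
def F (j : ℕ) (d : List Bool) : List Bool :=
  fLevel τ (boolPair (fstF (d.drop j)) (boolPair (unE j) (natE (bitsToNat (d.take j).reverse))))

/-- **The level function is polynomial time on codes** (level unary, data verbatim). [cite: AroraBarak2009, §1.3] -/
theorem codeFP_F : CodeFP (pairE unE strE) strE (fun p : ℕ × List Bool => F τ p.1 p.2) := by
  have hj : CodeFP (pairE unE strE) unE (fun p : ℕ × List Bool => p.1) := fst _ _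
  have hrev : CodeFP strE strE List.reverse := ⟨List.reverse, reverse_mem_FP, fun _ => rfl⟩
  have hfst : CodeFP strE strE fstF := ⟨fstF, fstF_mem_FP, fun _ => rfl⟩
  have hlev : CodeFP strE strE (fLevel τ) := ⟨fLevel τ, fLevel_mem_FP τ, fun _ => rfl⟩
  have hbp : CodeFP (pairE strE strE) strE (fun p : List Bool × List Bool => boolPair p.1 p.2) :=
    ⟨id, PolyTimeComputable.id _, fun _ => rfl⟩
  have hw : CodeFP (pairE unE strE) strE (fun p : ℕ × List Bool => fstF (p.2.drop p.1)) := (hfst.comp strDrop :)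
  have hh : CodeFP (pairE unE strE) natE (fun p : ℕ × List Bool => bitsToNat (p.2.take p.1).reverse) :=
    (strVal.comp (hrev.comp strTake) :)
  have hjs : CodeFP (pairE unE strE) strE (fun p : ℕ × List Bool => unE p.1) := (strOfUn.comp hj :)
  have hhs : CodeFP (pairE unE strE) strE (fun p : ℕ × List Bool => natE (bitsToNat (p.2.take p.1).reverse)) :=
    (strOfNat.comp hh :)
  have hin : CodeFP (pairE unE strE) strE (fun p : ℕ × List Bool =>
      boolPair (fstF (p.2.drop p.1)) (boolPair (unE p.1) (natE (bitsToNat (p.2.take p.1).reverse)))) :=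
    (hbp.comp (hw.pair (hbp.comp (hjs.pair hhs))) :)
  exact (hlev.comp hin).congr fun _ => rfl

/-- **The level function on a well-formed data word**: prefix `pre` of length `j`, then the padded code. [cite: Regev2009, Lemma 3.12 (proof)] -/
theorem F_apply (S : ℚ) (p U k ℓ j : ℕ) (pre pad : List Bool) (hpre : pre.length = j) :
    F τ j (pre ++ (pcode ((S, (p, U)), (k, ℓ)) ++ pad)) =
      wordOfNat k (aOf k (τ.tab' S p U ℓ j (bitsToNat pre.reverse)) (τ.tab' S p U ℓ (j + 1) (2 * bitsToNat pre.reverse))) := by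
  subst hpre
  rw [F, List.drop_left, List.take_left, fstF_pcode_append]
  exact fLevel_apply τ (((S, (p, U)), (k, ℓ)), (pre.length, bitsToNat pre.reverse))

/-! ### The machine -/

/-- One machine with a power time bound computes every level function on block inputs. [cite: AroraBarak2009, §1.3] -/
theorem exists_machine : ∃ (e : ℕ) (M : TM2ComputableAux Bool Bool), ∀ (j : ℕ) (d : List Bool),
    M.OutputsWithin (d ++ suffix (unE j) d.length) (F τ j d) (Tn e (d ++ suffix (unE j) d.length).length) :=
  exists_blockMachine (qE := unE) (codeFP_F τ)

/-- **The time exponent of the cosine machine.** [folklore] -/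
def cosE : ℕ := Classical.choose (exists_machine τ)

/-- **The cosine machine.** [cite: Regev2009, Lemma 3.12 (proof)] -/
def cosM : TM2ComputableAux Bool Bool := Classical.choose (Classical.choose_spec (exists_machine τ))

/-- The cosine machine outputs the level word within the time bound. [cite: Regev2009, Lemma 3.12 (proof)] -/
theorem cosM_outputs (j : ℕ) (d : List Bool) :
    (cosM τ).OutputsWithin (d ++ suffix (unE j) d.length) (F τ j d) (Tn (cosE τ) (d ++ suffix (unE j) d.length).length) :=
  Classical.choose_spec (Classical.choose_spec (exists_machine τ)) j d

/-! ### Suffixes, the window, and the machine datum -/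

/-- **The window length**: the largest block width over the levels, above the data bits. [folklore] -/
def wlen (ℓ np : ℕ) : ℕ := Finset.univ.sup fun j : Fin ℓ => width (cosE τ) (cosM τ) (j + np + (v np j).length) - (j + np)

/-- Every level's block fits in the window. [folklore] -/
theorem width_le_wlen {ℓ np : ℕ} (j : Fin ℓ) : width (cosE τ) (cosM τ) (j + np + (v np j).length) ≤ j + np + wlen τ ℓ np := by
  have h : width (cosE τ) (cosM τ) (j + np + (v np j).length) - (j + np) ≤ wlen τ ℓ np :=
    Finset.le_sup (f := fun j : Fin ℓ => width (cosE τ) (cosM τ) (j + np + (v np j).length) - (j + np)) (Finset.mem_univ j)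
  omega

/-- The machine hypothesis, output half: level `j`, data length `j + np`. [cite: Regev2009, Lemma 3.12 (proof)] -/
theorem outputs_v (np j : ℕ) (d : List Bool) (hd : d.length = j + np) :
    (cosM τ).OutputsWithin (d ++ v np j) (F τ j d) (Tn (cosE τ) (d.length + (v np j).length)) := by
  have h := cosM_outputs τ j d
  rw [List.length_append, hd] at h
  rw [hd]
  exact h

/-- The machine hypothesis, length half: on a data word whose parameter part is the parameter word the
level word has `k + 1` bits. [cite: Regev2009, Lemma 3.12 (proof) with §2 p. 11] -/
theorem length_F (S : ℚ) (p U k ℓ np : ℕ) (hnp : (pcode ((S, (p, U)), (k, ℓ))).length ≤ np) (j : ℕ) (d : List Bool)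
    (hd : d.length = j + np) (hc : d.drop j = List.ofFn (cword np ((S, (p, U)), (k, ℓ)))) : (F τ j d).length = k + 1 := by
  have hpre : (d.take j).length = j := by rw [List.length_take, hd]; omega
  have hsplit : d = d.take j ++ (pcode ((S, (p, U)), (k, ℓ)) ++ List.replicate (np - (pcode ((S, (p, U)), (k, ℓ))).length) false) := by
    rw [← ofFn_cword hnp, ← hc, List.take_append_drop]
  rw [hsplit, F_apply τ S p U k ℓ j (d.take j) _ hpre, wordOfNat_eq_cosWord, length_cosWord]

/-- **The machine hypothesis `MachOK` of every level.** [cite: Regev2009, Lemma 3.12 (proof)] -/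
theorem machOK (S : ℚ) (p U k ℓ np : ℕ) (hnp : (pcode ((S, (p, U)), (k, ℓ))).length ≤ np) (j : Fin ℓ) :
    GRWord.MachOK (GRData.kit ℓ np (wlen τ ℓ np) (k + 1)) (cosE τ) (cosM τ) (j + np) (v np j)
      (fun d => d.drop j = List.ofFn (cword np ((S, (p, U)), (k, ℓ)))) (F τ j) where
  out d hd _ := outputs_v τ np j d hd
  len d hd hc := by rw [length_F τ S p U k ℓ np hnp j d hd hc, GRData.kit_eq, GenKit.kit_k]

/-- The field cells fit in the read-out zone: `k + 1 ≤ JJ`. [folklore] -/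
theorem k_le_JJ (S : ℚ) (p U k ℓ np : ℕ) (hnp : (pcode ((S, (p, U)), (k, ℓ))).length ≤ np) (j : ℕ) :
    k + 1 ≤ JJ (cosE τ) (cosM τ) (j + np + (v np j).length) :=
  (k_le_length_pcode S p U k ℓ).trans (hnp.trans ((le_JJ (cosE τ) (cosM τ) (j + np + (v np j).length)).trans' (by omega)))

/-- **The field specification**: on the prefix of `y` followed by the parameter word the level word encodes
EXACTLY `machineA k T j y / 2ᵏ`. [cite: Regev2009, Lemma 3.12 (proof) with §2 p. 11] [cite: GroverRudolph2002, eq. (4)] -/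
theorem aTil_F (S : ℚ) (p U k ℓ np : ℕ) (hnp : (pcode ((S, (p, U)), (k, ℓ))).length ≤ np) (j : Fin ℓ) (y : Fin ℓ → Bool) :
    SLP.aTil (k + 1) (bitsToNat (F τ j ((List.ofFn fun i : Fin j => y ⟨i, lt_of_lt_of_le i.2 (le_of_lt j.2)⟩) ++
      List.ofFn (cword np ((S, (p, U)), (k, ℓ)))))) = (machineA k (τ.tab S p U ℓ) j y : ℝ) / 2 ^ k := by
  rw [ofFn_cword hnp, F_apply τ S p U k ℓ j _ _ (List.length_ofFn ..), ← hiVal_eq_bitsToNat_reverse y j (le_of_lt j.2),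
    wordOfNat_eq_cosWord, aTil_cosWord (aOf_le _ _ _), machineA, τ.tab'_eq S p U (le_of_lt j.2), τ.tab'_eq S p U (Nat.succ_le_of_lt j.2)]

/-- **The cosine machine datum of the concrete Grover–Rudolph block**: for the mass table
`τ.tab S p U ℓ` and precision `k`, on `np ≥ |pcode|` parameter wires holding `cword`, the field of
level `j` encodes EXACTLY the cosine `machineA k T j y / 2ᵏ`. [cite: Regev2009, Lemma 3.12 (proof) with §2 p. 11]
[cite: GroverRudolph2002, eq. (4)] -/
def mach (S : ℚ) (p U k ℓ np : ℕ) (hnp : (pcode ((S, (p, U)), (k, ℓ))).length ≤ np) :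
    GRData.Mach ℓ np (wlen τ ℓ np) (k + 1) (fun j y => (machineA k (τ.tab S p U ℓ) j y : ℝ) / 2 ^ k) where
  e := cosE τ
  M := cosM τ
  v j := v np j
  fbits j := F τ j
  c := cword np ((S, (p, U)), (k, ℓ))
  hM j := machOK τ S p U k ℓ np hnp j
  width_le j := width_le_wlen τ j
  k_le j := k_le_JJ τ S p U k ℓ np hnp j
  spec j y := aTil_F τ S p U k ℓ np hnp j y

/-- **The `Data` of the concrete Grover–Rudolph block with the cosine machine.** [cite: Regev2009, Lemma 3.12 (proof)] -/
def data (S : ℚ) (p U k ℓ np : ℕ) (hnp : (pcode ((S, (p, U)), (k, ℓ))).length ≤ np) :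
    GRBlock.Data (GRData.kit ℓ np (wlen τ ℓ np) (k + 1)) (GRData.ws ℓ np (wlen τ ℓ np) (k + 1)) (GRData.pw ℓ np (wlen τ ℓ np) (k + 1))
      (fun j y => (machineA k (τ.tab S p U ℓ) j y : ℝ) / 2 ^ k) :=
  GRData.data (mach τ S p U k ℓ np hnp) (Nat.succ_pos k) (abs_cosA_le_one k (τ.tab S p U ℓ)) (cosA_update k (τ.tab S p U ℓ))

/-- The parameter word of the datum (definitional). [folklore] -/
theorem mach_c (S : ℚ) (p U k ℓ np : ℕ) (hnp : (pcode ((S, (p, U)), (k, ℓ))).length ≤ np) :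
    (mach τ S p U k ℓ np hnp).c = cword np ((S, (p, U)), (k, ℓ)) := rfl

/-- The machine and the exponent of the datum are the one cosine machine and its exponent (definitional). [folklore] -/
theorem mach_M (S : ℚ) (p U k ℓ np : ℕ) (hnp : (pcode ((S, (p, U)), (k, ℓ))).length ≤ np) :
    (mach τ S p U k ℓ np hnp).M = cosM τ ∧ (mach τ S p U k ℓ np hnp).e = cosE τ := ⟨rfl, rfl⟩

/-- The suffixes of the datum (definitional). [folklore] -/
theorem mach_v (S : ℚ) (p U k ℓ np : ℕ) (hnp : (pcode ((S, (p, U)), (k, ℓ))).length ≤ np) (j : Fin ℓ) :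
    (mach τ S p U k ℓ np hnp).v j = v np j := rfl

/-- The output words of the datum (definitional). [folklore] -/
theorem mach_fbits (S : ℚ) (p U k ℓ np : ℕ) (hnp : (pcode ((S, (p, U)), (k, ℓ))).length ≤ np) (j : Fin ℓ) :
    (mach τ S p U k ℓ np hnp).fbits j = F τ j := rfl

end GRTableMach

end Literature.Computability.QuantumComplexity

end
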